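import Literature.Geometry.Kaehler.ComplexTorusLefschetzSL2ActionCharacterClosedForm
import Literature.Geometry.Kaehler.ComplexTorusLefschetzSL2ActionHodgeBigrading
import Literature.Geometry.Kaehler.ComplexTorusTotalLieAlgebraRatSemispinorial
import HarnessLib

/-!
# The characters of the two `SL₂(ℂ)`-subrepresentations `H^{ev}(X; ℂ)`, `H^{odd}(X; ℂ)` of a polarised complex torus:
# `tr(ρ(γ)|H^{ev}) = ((tr γ + 2)^g + (tr γ − 2)^g)/2`, `tr(ρ(γ)|H^{odd}) = ((tr γ + 2)^g − (tr γ − 2)^g)/2`,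
# `tr((−1)^* ∘ ρ(γ)) = (tr γ − 2)^g`, `dim H^{ev} = dim H^{odd} = 2^{2g−1}`

Layer `Literature/Geometry/Kaehler`, namespace `Literature.Geometry.Kaehler.ComplexTorus`; lane `lit-hodgefound` (Track 2 foundations
library), prover seat `lit-hodgefound-p09` (generation 53, row g53-#8).  THEOREMS ONLY (no definition, no named fact, no instance, no
notation; D-0026 net debt `0`).  Sequel of rows g53-#7 `ComplexTorusLefschetzSL2ActionCharacterClosedForm` (**`tr ρ(γ) = (tr γ + 2)^g`
for every `γ ∈ SL₂(ℂ)`**), g53-#1 `ComplexTorusLefschetzSL2ActionHodgeBigrading` (§4 Parity: `rotG_pi_apply` — the rotation by `π`,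
`(−1)^*`, acts by `(−1)^m` on `H^m`; `commute_rotG_pi_sl2Rep`; `mem_evenForms_iff_rotG_pi`, `mem_oddForms_iff_rotG_pi`;
`sl2Rep_apply_mem_evenForms/oddForms`: `H^{ev}`, `H^{odd}` are `SL₂(ℂ)`-stable) and of `ComplexTorusTotalLieAlgebraRatSemispinorial`
(`evenPart`, `oddPart`, `evenPart_add_oddPart`).

SETTING. `E` a complex normed space of dimension `g ≥ 1` (`V = H₁(X; ℝ)`), `H•(X; ℂ) = GForm E ℂ` graded by `h = countingG E`
(`k − g` on `Hᵏ`), `η` a non-degenerate real `2`-form (`hη`), `ρ = (hasLefschetzProperty_lefschetzG hη).sl2Rep isZGrading_countingG`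
Beauville's action, `H^{ev} = evenForms E = ⊕ H^{2k}`, `H^{odd} = oddForms E`, `(−1)^* = rotG E π`.

## What is proved

* §1 `isCompl_evenForms_oddForms` (`H•(X; ℂ) = H^{ev} ⊕ H^{odd}`); **`rotG_pi_eq_smul_torus_neg_one`**: `(−1)^* = (−1)^g · (−1)ʰ`
  (`(−1)ʰ = ρ(−1)` acts by `(−1)^{k−g}` on `Hᵏ`), `rotG_pi_eq_smul_sl2Rep_neg_one`; `trace_sl2Rep_neg` (`tr ρ(−γ) = (2 − tr γ)^g`) and
  **`trace_rotG_pi_mul_sl2Rep`: `tr((−1)^* ∘ ρ(γ)) = (tr γ − 2)^g`** — the SUPERTRACE of `ρ(γ)` (`tr` on `H^{ev}` minus `tr` on `H^{odd}`)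
  is `(tr γ − 2)^g = (μ − 2 + μ⁻¹)^g = (−1)^g μ^{−g}(1 − μ)^{2g}`, the signed Poincaré polynomial `Σ (−1)^k b_k t^k = (1 − t)^{2g}`.
* §2 **`trace_sl2Rep_restrict_evenForms`: `tr(ρ(γ)|H^{ev}) = ((tr γ + 2)^g + (tr γ − 2)^g)/2`**, **`trace_sl2Rep_restrict_oddForms`:
  `tr(ρ(γ)|H^{odd}) = ((tr γ + 2)^g − (tr γ − 2)^g)/2`** (from `tr = tr|ev + tr|odd` for the complementary stable subspaces and
  `tr((−1)^* ρ(γ)) = tr|ev − tr|odd`, `(−1)^* = ±1` on `H^{ev}` ∕ `H^{odd}`); the dimensions **`finrank_evenForms`, `finrank_oddForms`: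
  `dim H^{ev}(X; ℂ) = dim H^{odd}(X; ℂ) = 2^{2g−1}`** (`γ = 1`: `(4^g ± 0^g)/2`; Looijenga–Lunts: both are semispinorial
  representations of `𝔤_tot ≅ 𝔰𝔬(V ⊕ V^*) = 𝔰𝔬(4g)`, of dimension `2^{2g−1}`); and the Weyl operator: `trace_weylOperator_restrict_evenForms`
  (`tr(w|H^{ev}) = (2^g + (−2)^g)/2`), `trace_weylOperator_restrict_oddForms` (`= (2^g − (−2)^g)/2`): `w` is traceless on `H^{odd}` for
  even `g` and on `H^{ev}` for odd `g`.

## Sources, VERBATIM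

* A. Beauville, *The action of SL₂ on abelian varieties*, J. Ramanujan Math. Soc. 25 (2010) [Beauville2010SL2] (held text
  `paper:arxiv-0805.1541`), §3 Proposition (ii) ("`h² = β(−I)`"), §4 Theorem (p0005): "`(n 0 ; 0 n⁻¹)·z = n^{−g} n^*z`, […] In particular,
  `H` is diagonalizable and `X, Y` are nilpotent".
* E. Looijenga, V. A. Lunts, *A Lie algebra attached to a projective variety*, Invent. Math. 129 (1997) [LooijengaLunts1997] (held text
  `paper:arxiv-alg-geom-9604014`), §3 (p0027–p0028): "Now let `X` be a real torus of even dimension `2n`. We identify the universal cover of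
  `X` with `H₁(X; ℝ)`. We will write `V` for this real vector space (of dimension `2n`) so that `H(X; ℝ) = Λ•V^*`. […] (3.3) Proposition.
  There is a natural identification `(𝔤_tot(X; ℝ), h) ≅ (𝔰𝔬(V^* ⊕ V))` […] a semispinorial representation of `𝔤_tot(X; ℝ)`" (the even
  and the odd part `H^{ev}(X)[n]`, `H^{odd}(X)[n]`).
* W. Fulton, J. Harris, *Representation Theory. A First Course*, GTM 129 [FultonHarris1991], §23.2 (23.40) "the trace of `exp(X)` on `V`
  is `Σ m_α e^{α(X)}`"; §20.1 (the two half-spin representations of `𝔰𝔬_{2n}ℂ`, of dimension `2^{n−1}`).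
* H. Lange, *Abelian Varieties over the Complex Numbers* (2023) [Lange2023AbelianVarietiesComplex], §1.1.3 Cor. 1.1.19 (`H^n(X, ℤ) ≅ Λⁿ H¹`
  free of rank `C(2g, n)`).
* C. Voisin, *Hodge Theory and Complex Algebraic Geometry I* (2002) [Voisin2002], §2.3.1 (multilinearity: `(−1)^* = (−1)^m` on
  `m`-forms).

## Scope

Characters (traces) only; the identification of `H^{ev}`, `H^{odd}` as (semi)spinorial `𝔰𝔬(4g)`-modules is the tree's
`ComplexTorusHalfSpinWeights` ∕ `ComplexTorusTotalLieAlgebraRatSemispinorial` and is not restated.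
-/

noncomputable section

-- `Module ℂ` / `SMulZeroClass ℂ` synthesis on `E [⋀^Fin k]→L[ℝ] ℂ` (as in `ComplexTorusLefschetzDecomposition`)
set_option maxSynthPendingDepth 3

namespace Literature.Geometry.Kaehler

namespace ComplexTorus

open Module Function Finset Complex
open scoped MatrixGroups Real
open Literature.LinearAlgebra.Alternating Literature.Algebra.Lie

universe uE

variable {E : Type uE} [NormedAddCommGroup E] [NormedSpace ℂ E] [FiniteDimensional ℂ E] [Nontrivial E] {η : E [⋀^Fin 2]→L[ℝ] ℝ}

/-! ## §0 Two pieces of linear algebra -/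

/-- `tr f = tr f|_p + tr f|_q` for complementary `f`-stable subspaces (`f` is conjugate to `f|_p × f|_q` on `p × q ≃ M`). [folklore] -/
private theorem trace_eq_add_of_isCompl₇₈ {V : Type*} [AddCommGroup V] [Module ℂ V] [FiniteDimensional ℂ V] {p q : Submodule ℂ V}
    (hpq : IsCompl p q)
    (f : Module.End ℂ V) (hp : ∀ x ∈ p, f x ∈ p) (hq : ∀ x ∈ q, f x ∈ q) :
    LinearMap.trace ℂ V f = LinearMap.trace ℂ p (f.restrict hp) + LinearMap.trace ℂ q (f.restrict hq) := by
  have h : f = (Submodule.prodEquivOfIsCompl p q hpq).conj (LinearMap.prodMap (f.restrict hp) (f.restrict hq)) := by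
    rw [LinearEquiv.conj_apply, LinearEquiv.eq_comp_toLinearMap_symm]
    ext x
    · simp [LinearMap.restrict_apply]
    · simp [LinearMap.restrict_apply]
  conv_lhs => rw [h]
  rw [LinearMap.trace_conj', LinearMap.trace_prodMap']

/-- Restrictions of equal maps are equal (the stability proofs are irrelevant). [folklore] -/
private theorem restrict_congr₇₈ {V : Type*} [AddCommGroup V] [Module ℂ V] {p : Submodule ℂ V} {f f' : Module.End ℂ V} (h : f = f')
    (hf : ∀ x ∈ p, f x ∈ p) (hf' : ∀ x ∈ p, f' x ∈ p) : f.restrict hf = f'.restrict hf' := by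
  subst h
  rfl

/-! ## §1 `H• = H^{ev} ⊕ H^{odd}`, `(−1)^* = (−1)^g (−1)ʰ` and the supertrace `tr((−1)^* ρ(γ)) = (tr γ − 2)^g` -/

omit [FiniteDimensional ℂ E] [Nontrivial E] in
/-- **`H•(X; ℂ) = H^{ev}(X; ℂ) ⊕ H^{odd}(X; ℂ)`**: complementary subspaces. [cite: LooijengaLunts1997, §3 (3.3) and §1 (1.7)] -/
theorem isCompl_evenForms_oddForms : IsCompl (evenForms E) (oddForms E) := by
  refine ⟨Submodule.disjoint_def.2 fun w hev hodd ↦ funext fun m ↦ ?_, codisjoint_iff.2 (eq_top_iff.2 fun w _ ↦ ?_)⟩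
  · rcases Nat.even_or_odd m with hm | hm
    · exact hodd m hm
    · exact hev m hm
  · rw [← evenPart_add_oddPart w]
    exact Submodule.add_mem_sup (evenPart_mem_evenForms w) (oddPart_mem_oddForms w)

omit [Nontrivial E] in
/-- **`(−1)^* = (−1)^g · (−1)ʰ`**: the rotation by `π` acts by `(−1)^k` on `Hᵏ = M_{k−g}` and the torus element `(−1)ʰ` by `(−1)^{k−g}`.
[cite: Voisin2002, §2.3.1] [cite: Beauville2010SL2, §4 Theorem ("(n 0 ; 0 n⁻¹)·z = n^{−g} n^*z")] -/
theorem rotG_pi_eq_smul_torus_neg_one :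
    rotG E π = ((-1 : ℂ) ^ finrank ℂ E) • (isZGrading_countingG (E := E)).torus (-1) := by
  refine (isZGrading_countingG (E := E)).linearMap_ext fun m x hx ↦ ?_
  rw [LinearMap.smul_apply, (isZGrading_countingG (E := E)).torus_apply_of_mem (-1) hx, smul_smul]
  rcases lt_or_ge m (-(finrank ℂ E : ℤ)) with hm | hm
  · rw [degreeSpace_countingG_eq_bot_of_lt hm, Submodule.mem_bot] at hx
    rw [hx, map_zero, smul_zero]
  · obtain ⟨k, rfl⟩ : ∃ k : ℕ, m = (k : ℤ) - (finrank ℂ E : ℤ) := ⟨(m + finrank ℂ E).toNat, by omega⟩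
    have hk := mem_degreeSpace_countingG_iff.1 hx
    have hsc : (-1 : ℂ) ^ finrank ℂ E * (-1) ^ ((k : ℤ) - (finrank ℂ E : ℤ)) = (-1) ^ k := by
      rw [zpow_sub₀ (neg_ne_zero.2 one_ne_zero), zpow_natCast, zpow_natCast, mul_div_cancel₀ _ (pow_ne_zero _ (neg_ne_zero.2 one_ne_zero))]
    rw [hsc]
    funext j
    rw [rotG_pi_apply, Pi.smul_apply]
    by_cases hj : j = k
    · rw [hj]
    · rw [hk j hj, smul_zero, smul_zero]

/-- **`(−1)^* = (−1)^g · ρ(−1)`** (`ρ(−1) = w² = (−1)ʰ`). [cite: Beauville2010SL2, §3 Proposition (ii) ("h² = β(−I)") and §4 Theorem]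
[cite: Voisin2002, §2.3.1] -/
theorem rotG_pi_eq_smul_sl2Rep_neg_one (hη : ∀ v : E, v ≠ 0 → ∃ w : E, η ![v, w] ≠ 0) :
    rotG E π = ((-1 : ℂ) ^ finrank ℂ E) • (hasLefschetzProperty_lefschetzG hη).sl2Rep isZGrading_countingG (-1) := by
  rw [(hasLefschetzProperty_lefschetzG hη).sl2Rep_neg_one isZGrading_countingG,
    (hasLefschetzProperty_lefschetzG hη).weylOperator_mul_weylOperator isZGrading_countingG, rotG_pi_eq_smul_torus_neg_one]

/-- **`tr ρ(−γ) = (2 − tr γ)^g`.** [cite: Beauville2010SL2, §4 Theorem] [cite: JorgensonLang2008, §5.1] [cite: FultonHarris1991, §23.2 (23.40)] -/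
theorem trace_sl2Rep_neg (hη : ∀ v : E, v ≠ 0 → ∃ w : E, η ![v, w] ≠ 0) (γ : SL(2, ℂ)) :
    LinearMap.trace ℂ (GForm E ℂ) ((hasLefschetzProperty_lefschetzG hη).sl2Rep isZGrading_countingG (-γ)) =
      (2 - (γ : Matrix (Fin 2) (Fin 2) ℂ).trace) ^ finrank ℂ E := by
  rw [trace_sl2Rep_eq_trace_add_two_pow hη, Matrix.SpecialLinearGroup.coe_neg, Matrix.trace_neg, neg_add_eq_sub]

/-- **THE SUPERTRACE `tr((−1)^* ∘ ρ(γ)) = (tr γ − 2)^g`** (`= (−1)^g tr ρ(−γ)`): the trace of `ρ(γ)` on `H^{ev}` minus its trace on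
`H^{odd}` is the signed Poincaré polynomial `(−1)^g μ^{−g} (1 − μ)^{2g}` at a characteristic root `μ`. [cite: Beauville2010SL2, §4 Theorem]
[cite: LooijengaLunts1997, §3 (3.3)] [cite: FultonHarris1991, §23.2 (23.40)] -/
theorem trace_rotG_pi_mul_sl2Rep (hη : ∀ v : E, v ≠ 0 → ∃ w : E, η ![v, w] ≠ 0) (γ : SL(2, ℂ)) :
    LinearMap.trace ℂ (GForm E ℂ) (rotG E π * (hasLefschetzProperty_lefschetzG hη).sl2Rep isZGrading_countingG γ) =
      ((γ : Matrix (Fin 2) (Fin 2) ℂ).trace - 2) ^ finrank ℂ E := by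
  rw [rotG_pi_eq_smul_sl2Rep_neg_one hη, smul_mul_assoc, ← map_mul, neg_one_mul, map_smul, trace_sl2Rep_neg hη γ, smul_eq_mul,
    ← mul_pow]
  ring

/-! ## §2 The characters of `H^{ev}` and `H^{odd}` -/

/-- `tr(ρ(γ)|H^{ev}) + tr(ρ(γ)|H^{odd}) = tr ρ(γ) = (tr γ + 2)^g`. [cite: LooijengaLunts1997, §3 (3.3)] [cite: Beauville2010SL2, §4 Theorem] -/
theorem trace_sl2Rep_restrict_evenForms_add (hη : ∀ v : E, v ≠ 0 → ∃ w : E, η ![v, w] ≠ 0) (γ : SL(2, ℂ)) :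
    LinearMap.trace ℂ ↥(evenForms E) (((hasLefschetzProperty_lefschetzG hη).sl2Rep isZGrading_countingG γ).restrict
        fun _ hω ↦ sl2Rep_apply_mem_evenForms hη γ hω) +
      LinearMap.trace ℂ ↥(oddForms E) (((hasLefschetzProperty_lefschetzG hη).sl2Rep isZGrading_countingG γ).restrict
        fun _ hω ↦ sl2Rep_apply_mem_oddForms hη γ hω) =
      ((γ : Matrix (Fin 2) (Fin 2) ℂ).trace + 2) ^ finrank ℂ E := by
  rw [← trace_eq_add_of_isCompl₇₈ isCompl_evenForms_oddForms, trace_sl2Rep_eq_trace_add_two_pow hη γ]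

/-- `tr(ρ(γ)|H^{ev}) − tr(ρ(γ)|H^{odd}) = tr((−1)^* ρ(γ)) = (tr γ − 2)^g` (`(−1)^* = ±1` on `H^{ev}` ∕ `H^{odd}`).
[cite: LooijengaLunts1997, §3 (3.3)] [cite: Voisin2002, §2.3.1] [cite: Beauville2010SL2, §4 Theorem] -/
theorem trace_sl2Rep_restrict_evenForms_sub (hη : ∀ v : E, v ≠ 0 → ∃ w : E, η ![v, w] ≠ 0) (γ : SL(2, ℂ)) :
    LinearMap.trace ℂ ↥(evenForms E) (((hasLefschetzProperty_lefschetzG hη).sl2Rep isZGrading_countingG γ).restrict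
        fun _ hω ↦ sl2Rep_apply_mem_evenForms hη γ hω) -
      LinearMap.trace ℂ ↥(oddForms E) (((hasLefschetzProperty_lefschetzG hη).sl2Rep isZGrading_countingG γ).restrict
        fun _ hω ↦ sl2Rep_apply_mem_oddForms hη γ hω) =
      ((γ : Matrix (Fin 2) (Fin 2) ℂ).trace - 2) ^ finrank ℂ E := by
  have hp : ∀ ω ∈ evenForms E, (rotG E π * (hasLefschetzProperty_lefschetzG hη).sl2Rep isZGrading_countingG γ) ω ∈ evenForms E :=
    fun ω hω ↦ by
      rw [Module.End.mul_apply, mem_evenForms_iff_rotG_pi.1 (sl2Rep_apply_mem_evenForms hη γ hω)]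
      exact sl2Rep_apply_mem_evenForms hη γ hω
  have hq : ∀ ω ∈ oddForms E, (rotG E π * (hasLefschetzProperty_lefschetzG hη).sl2Rep isZGrading_countingG γ) ω ∈ oddForms E :=
    fun ω hω ↦ by
      rw [Module.End.mul_apply, mem_oddForms_iff_rotG_pi.1 (sl2Rep_apply_mem_oddForms hη γ hω)]
      exact Submodule.neg_mem _ (sl2Rep_apply_mem_oddForms hη γ hω)
  have hev : (rotG E π * (hasLefschetzProperty_lefschetzG hη).sl2Rep isZGrading_countingG γ).restrict hp =
      ((hasLefschetzProperty_lefschetzG hη).sl2Rep isZGrading_countingG γ).restrict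
        fun _ hω ↦ sl2Rep_apply_mem_evenForms hη γ hω :=
    LinearMap.ext fun x ↦ Subtype.ext (by
      rw [LinearMap.coe_restrict_apply, LinearMap.coe_restrict_apply, Module.End.mul_apply,
        mem_evenForms_iff_rotG_pi.1 (sl2Rep_apply_mem_evenForms hη γ x.2)])
  have hodd : (rotG E π * (hasLefschetzProperty_lefschetzG hη).sl2Rep isZGrading_countingG γ).restrict hq =
      -(((hasLefschetzProperty_lefschetzG hη).sl2Rep isZGrading_countingG γ).restrict
        fun _ hω ↦ sl2Rep_apply_mem_oddForms hη γ hω) :=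
    LinearMap.ext fun x ↦ Subtype.ext (by
      rw [LinearMap.coe_restrict_apply, LinearMap.neg_apply, Submodule.coe_neg, LinearMap.coe_restrict_apply, Module.End.mul_apply,
        mem_oddForms_iff_rotG_pi.1 (sl2Rep_apply_mem_oddForms hη γ x.2)])
  rw [← trace_rotG_pi_mul_sl2Rep hη γ, trace_eq_add_of_isCompl₇₈ isCompl_evenForms_oddForms _ hp hq, hev, hodd, map_neg,
    sub_eq_add_neg]

/-- **THE CHARACTER OF `H^{ev}(X; ℂ)`: `tr(ρ(γ)|H^{ev}) = ((tr γ + 2)^g + (tr γ − 2)^g)/2`** for every `γ ∈ SL₂(ℂ)`.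
[cite: LooijengaLunts1997, §3 (3.3)] [cite: Beauville2010SL2, §4 Theorem] [cite: FultonHarris1991, §23.2 (23.40)] -/
theorem trace_sl2Rep_restrict_evenForms (hη : ∀ v : E, v ≠ 0 → ∃ w : E, η ![v, w] ≠ 0) (γ : SL(2, ℂ)) :
    LinearMap.trace ℂ ↥(evenForms E) (((hasLefschetzProperty_lefschetzG hη).sl2Rep isZGrading_countingG γ).restrict
        fun _ hω ↦ sl2Rep_apply_mem_evenForms hη γ hω) =
      (((γ : Matrix (Fin 2) (Fin 2) ℂ).trace + 2) ^ finrank ℂ E + ((γ : Matrix (Fin 2) (Fin 2) ℂ).trace - 2) ^ finrank ℂ E) / 2 := by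
  linear_combination (trace_sl2Rep_restrict_evenForms_add hη γ + trace_sl2Rep_restrict_evenForms_sub hη γ) / 2

/-- **THE CHARACTER OF `H^{odd}(X; ℂ)`: `tr(ρ(γ)|H^{odd}) = ((tr γ + 2)^g − (tr γ − 2)^g)/2`** for every `γ ∈ SL₂(ℂ)`.
[cite: LooijengaLunts1997, §3 (3.3)] [cite: Beauville2010SL2, §4 Theorem] [cite: FultonHarris1991, §23.2 (23.40)] -/
theorem trace_sl2Rep_restrict_oddForms (hη : ∀ v : E, v ≠ 0 → ∃ w : E, η ![v, w] ≠ 0) (γ : SL(2, ℂ)) :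
    LinearMap.trace ℂ ↥(oddForms E) (((hasLefschetzProperty_lefschetzG hη).sl2Rep isZGrading_countingG γ).restrict
        fun _ hω ↦ sl2Rep_apply_mem_oddForms hη γ hω) =
      (((γ : Matrix (Fin 2) (Fin 2) ℂ).trace + 2) ^ finrank ℂ E - ((γ : Matrix (Fin 2) (Fin 2) ℂ).trace - 2) ^ finrank ℂ E) / 2 := by
  linear_combination (trace_sl2Rep_restrict_evenForms_add hη γ - trace_sl2Rep_restrict_evenForms_sub hη γ) / 2

/-! ## §3 `tr (−1)^* = 0` and `dim H^{ev} = dim H^{odd} = 2^{2g−1}` (no polarisation needed) -/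

/-- **`tr (−1)^* = 0` on `H•(X; ℂ)`** (`g ≥ 1`): `(−1)^* = (−1)^g (−1)ʰ` and `tr (−1)ʰ = Σ_k C(2g, k) (−1)^{k−g} = ±(1 − 1)^{2g} = 0`.
[cite: Voisin2002, §2.3.1] [cite: Lange2023AbelianVarietiesComplex, §1.1.3 Cor. 1.1.19] -/
theorem trace_rotG_pi : LinearMap.trace ℂ (GForm E ℂ) (rotG E π) = 0 := by
  rw [rotG_pi_eq_smul_torus_neg_one, map_smul, trace_torus_countingG, sum_choose_mul_zpow_sub _ (neg_ne_zero.2 one_ne_zero),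
    add_neg_cancel, zero_pow (by have := finrank_pos (R := ℂ) (M := E); omega), mul_zero, smul_zero]

omit [Nontrivial E] in
/-- **`tr (−1)^* = dim H^{ev} − dim H^{odd}`**: `(−1)^*` is `+1` on `H^{ev}` and `−1` on `H^{odd}`. [cite: Voisin2002, §2.3.1]
[cite: LooijengaLunts1997, §3 (3.3)] -/
theorem trace_rotG_pi_eq_sub :
    LinearMap.trace ℂ (GForm E ℂ) (rotG E π) = (finrank ℂ ↥(evenForms E) : ℂ) - (finrank ℂ ↥(oddForms E) : ℂ) := by
  have hp : ∀ ω ∈ evenForms E, rotG E π ω ∈ evenForms E := fun ω hω ↦ by rwa [mem_evenForms_iff_rotG_pi.1 hω]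
  have hq : ∀ ω ∈ oddForms E, rotG E π ω ∈ oddForms E := fun ω hω ↦ by
    rw [mem_oddForms_iff_rotG_pi.1 hω]
    exact Submodule.neg_mem _ hω
  have hev : (rotG E π).restrict hp = LinearMap.id :=
    LinearMap.ext fun x ↦ Subtype.ext (by rw [LinearMap.coe_restrict_apply, mem_evenForms_iff_rotG_pi.1 x.2, LinearMap.id_apply])
  have hodd : (rotG E π).restrict hq = -LinearMap.id :=
    LinearMap.ext fun x ↦ Subtype.ext (by
      rw [LinearMap.coe_restrict_apply, mem_oddForms_iff_rotG_pi.1 x.2, LinearMap.neg_apply, LinearMap.id_apply, Submodule.coe_neg])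
  rw [trace_eq_add_of_isCompl₇₈ isCompl_evenForms_oddForms _ hp hq, hev, hodd, map_neg, LinearMap.trace_id, LinearMap.trace_id,
    sub_eq_add_neg]

/-- **`dim H^{ev}(X; ℂ) = dim H^{odd}(X; ℂ)`** (`g ≥ 1`; `tr (−1)^* = 0`). [cite: LooijengaLunts1997, §3 (3.3)]
[cite: Lange2023AbelianVarietiesComplex, §1.1.3 Cor. 1.1.19] -/
theorem finrank_evenForms_eq_finrank_oddForms : finrank ℂ ↥(evenForms E) = finrank ℂ ↥(oddForms E) := by
  have h := trace_rotG_pi_eq_sub (E := E)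
  rw [trace_rotG_pi, eq_comm, sub_eq_zero] at h
  exact_mod_cast h

omit [Nontrivial E] in
/-- `dim H^{ev} + dim H^{odd} = dim H•(X; ℂ) = 2^{2g}`. [cite: LooijengaLunts1997, §3 (3.3)] [cite: Lange2023AbelianVarietiesComplex, §1.1.3 Cor. 1.1.19] -/
theorem finrank_evenForms_add_finrank_oddForms :
    finrank ℂ ↥(evenForms E) + finrank ℂ ↥(oddForms E) = 2 ^ (2 * finrank ℂ E) := by
  rw [Submodule.finrank_add_eq_of_isCompl isCompl_evenForms_oddForms, finrank_gForm]

/-- **`dim_ℂ H^{ev}(X; ℂ) = 2^{2g−1}`** (the dimension of a semispinorial representation of `𝔰𝔬(V ⊕ V^*) = 𝔰𝔬(4g)`).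
[cite: LooijengaLunts1997, §3 (3.3)] [cite: FultonHarris1991, §20.1] [cite: Lange2023AbelianVarietiesComplex, §1.1.3 Cor. 1.1.19] -/
theorem finrank_evenForms : finrank ℂ ↥(evenForms E) = 2 ^ (2 * finrank ℂ E - 1) := by
  have h1 := finrank_evenForms_add_finrank_oddForms (E := E)
  have h2 : 2 ^ (2 * finrank ℂ E) = 2 * 2 ^ (2 * finrank ℂ E - 1) := by
    rw [← pow_succ']
    congr 1
    have := finrank_pos (R := ℂ) (M := E)
    omega
  rw [← finrank_evenForms_eq_finrank_oddForms, h2] at h1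
  omega

/-- **`dim_ℂ H^{odd}(X; ℂ) = 2^{2g−1}`.** [cite: LooijengaLunts1997, §3 (3.3)] [cite: FultonHarris1991, §20.1]
[cite: Lange2023AbelianVarietiesComplex, §1.1.3 Cor. 1.1.19] -/
theorem finrank_oddForms : finrank ℂ ↥(oddForms E) = 2 ^ (2 * finrank ℂ E - 1) := by
  rw [← finrank_evenForms_eq_finrank_oddForms, finrank_evenForms]

/-! ## §4 The Weyl operator on `H^{ev}` and `H^{odd}` -/

/-- **`tr(w|H^{ev}) = (2^g + (−2)^g)/2`**: the Weyl operator `w = ρ(0 −1 ; 1 0)` (trace `0`) on the even cohomology — `2^g` for even `g`,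
`0` for odd `g`. [cite: Beauville2010SL2, §3 Theorem ("φ(0 −1 ; 1 0)")] [cite: LooijengaLunts1997, §3 (3.3)] -/
theorem trace_weylOperator_restrict_evenForms (hη : ∀ v : E, v ≠ 0 → ∃ w : E, η ![v, w] ≠ 0) :
    LinearMap.trace ℂ ↥(evenForms E) (((hasLefschetzProperty_lefschetzG hη).weylOperator isZGrading_countingG).restrict
        fun _ hω ↦ weylOperator_apply_mem_evenForms hη hω) = ((2 : ℂ) ^ finrank ℂ E + (-2) ^ finrank ℂ E) / 2 := by
  obtain ⟨γ, hγ⟩ : ∃ γ : SL(2, ℂ), (γ : Matrix (Fin 2) (Fin 2) ℂ) = !![0, -1; 1, 0] := ⟨⟨_, by simp [Matrix.det_fin_two_of]⟩, rfl⟩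
  rw [restrict_congr₇₈ ((hasLefschetzProperty_lefschetzG hη).sl2Rep_apply_of_coe_eq_weyl isZGrading_countingG γ hγ).symm _
    fun _ hω ↦ sl2Rep_apply_mem_evenForms hη γ hω, trace_sl2Rep_restrict_evenForms hη γ, hγ, Matrix.trace_fin_two_of, add_zero,
    zero_add, zero_sub]

/-- **`tr(w|H^{odd}) = (2^g − (−2)^g)/2`**: `0` for even `g`, `2^g` for odd `g`. [cite: Beauville2010SL2, §3 Theorem ("φ(0 −1 ; 1 0)")]
[cite: LooijengaLunts1997, §3 (3.3)] -/
theorem trace_weylOperator_restrict_oddForms (hη : ∀ v : E, v ≠ 0 → ∃ w : E, η ![v, w] ≠ 0) :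
    LinearMap.trace ℂ ↥(oddForms E) (((hasLefschetzProperty_lefschetzG hη).weylOperator isZGrading_countingG).restrict
        fun _ hω ↦ weylOperator_apply_mem_oddForms hη hω) = ((2 : ℂ) ^ finrank ℂ E - (-2) ^ finrank ℂ E) / 2 := by
  obtain ⟨γ, hγ⟩ : ∃ γ : SL(2, ℂ), (γ : Matrix (Fin 2) (Fin 2) ℂ) = !![0, -1; 1, 0] := ⟨⟨_, by simp [Matrix.det_fin_two_of]⟩, rfl⟩
  rw [restrict_congr₇₈ ((hasLefschetzProperty_lefschetzG hη).sl2Rep_apply_of_coe_eq_weyl isZGrading_countingG γ hγ).symm _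
    fun _ hω ↦ sl2Rep_apply_mem_oddForms hη γ hω, trace_sl2Rep_restrict_oddForms hη γ, hγ, Matrix.trace_fin_two_of, add_zero,
    zero_add, zero_sub]

end ComplexTorus

end Literature.Geometry.Kaehler

end
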